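import Summits.HodgeConjecture.CorCM.Census.CyclicBoundarySlide

/-!
# Boundary sets of cyclic CM types, II: every boundary set of size `≥ 3` has a potential-lowering pair of places

COR-CM (cell `pub-hodgecm2`), count-neutral kernel combinatorics by the binder seat b23 (gen 38; lane CYCLIC-FACES, part II, sequel of
`Census/CyclicBoundaryWindows.lean` / `Census/CyclicBoundarySlide.lean`).  Theorems only; no certificate, no `decide` table, no named fact,
no geometry, no `sorry`.  HONEST FRAMING: `HC_CM` is NOT proved, here or anywhere in the tree; nothing here is a period or a headline.

CONTENT.  In the boundary-set model (part III makes the dictionary precise) a rank-four face of a cyclic CM type with boundary set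
`T ⊂ ℤ/n` at the places `p ≠ q` has the four corners `T`, `T ∆ {p−1, p}`, `T ∆ {q−1, q}`, `T ∆ {p−1, p} ∆ {q−1, q}`.  The main theorem
**`exists_places`**: for EVERY `T` with `|T| ≥ 3` there are places `p ≠ q` such that the three corners other than `T` have strictly smaller
potential `pot` (`|T|` drops, or `|T|` stays and the window count `W` grows).  The places are chosen by
* RULE M (`ruleM`, the least right gap `z = gap T t` is `≥ 2`): `p = t + 1`, `q = t + z` — the two corners are slides of `t` / `t + z` into
  the shortest gap (`W` grows by `W_slide_right` / `W_slide_left` and the minimum symmetry), the double corner is two such slides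
  (`z ≥ 3`) or annihilates `t, t + 2` (`z = 2`);
* RULE S (the least right gap is `1`, i.e. `t, t + 1 ∈ T`): `p = t + 1` annihilates `t, t + 1`; with `u` a member of least right gap
  `w` among `T ∖ {t}`: `q = u + 1` if `w = 1` (`ruleS_one`) or `u ≠ t + 1` (`ruleS_far`, a slide of `u` to the right), and `q = u + w` if
  `u = t + 1` (`ruleS_near`, a slide of the successor of `u` to the left; it is not `t` because `|T| ≥ 3`).
All [folklore] (elementary counting); the exhaustive numerical check of this statement for `n ≤ 13` is in the seat's `tools/rules.py`.

## References
* [Pohlmann1968] H. Pohlmann, Algebraic cycles on abelian varieties of complex multiplication type, Ann. of Math. 88 (1968), Thm 1.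
-/

namespace Summit.HodgeConjecture.CorCM.Census.CyclicBoundary

open Finset
open scoped symmDiff

variable {n : ℕ} [NeZero n]

/-! ## §1 Small helpers -/

/-- A set of size `≥ 3` lives in `ℤ/n` with `n ≥ 3`. [folklore] -/
theorem three_le_of_card {T : Finset (ZMod n)} (h3 : 3 ≤ T.card) : 3 ≤ n := by
  have h := Finset.card_le_univ T
  rw [ZMod.card] at h
  omega

omit [NeZero n] in
/-- `t + 1 ≠ t` once `n ≥ 2`. [folklore] -/
theorem add_one_ne (hn : 2 ≤ n) (t : ZMod n) : t + 1 ≠ t := by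
  intro h
  have h1 : ((1 : ℕ) : ZMod n) = 0 := by
    rw [Nat.cast_one]
    have := congrArg (fun y => y - t) h
    simpa using this
  have := Nat.eq_zero_of_dvd_of_lt ((ZMod.natCast_eq_zero_iff _ _).mp h1) (by omega)
  omega

omit [NeZero n] in
/-- Cancelling `t` and comparing natural offsets below `n`. [folklore] -/
theorem eq_of_add_natCast_eq {t : ZMod n} {a b : ℕ} (ha : a < n) (hb : b < n) (h : t + (a : ZMod n) = t + (b : ZMod n)) : a = b :=
  natCast_inj_of_lt ha hb (add_left_cancel h)

omit [NeZero n] in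
/-- Toggling a pair that meets `S` does not increase the size. [folklore] -/
theorem card_symmDiff_pair_le {S : Finset (ZMod n)} {a b : ZMod n} (hab : a ≠ b) (h : a ∈ S ∨ b ∈ S) :
    (S ∆ {a, b}).card ≤ S.card := by
  by_cases ha : a ∈ S
  · by_cases hb : b ∈ S
    · rw [symmDiff_pair_of_mem_of_mem ha hb]; have := card_erase_erase ha hb hab; omega
    · rw [symmDiff_pair_of_mem_of_not_mem ha hb, card_insert_erase ha hb]
  · have hb : b ∈ S := h.resolve_left ha
    rw [symmDiff_pair_of_not_mem_of_mem ha hb, card_insert_erase hb ha]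

/-! ## §2 Rule M: the least gap has length `≥ 2` -/

/-- **RULE M.**  If the least right gap `z = gap T t` is `≥ 2`, the places `t + 1`, `t + z` lower the potential at all three corners.
[folklore] -/
theorem ruleM {T : Finset (ZMod n)} (h3 : 3 ≤ T.card) {t : ZMod n} (ht : t ∈ T) (hmin : ∀ v ∈ T, gap T t ≤ gap T v)
    (hz : 2 ≤ gap T t) :
    ∃ p q : ZMod n, p ≠ q ∧ pot (T ∆ {p - 1, p}) < pot T ∧ pot (T ∆ {q - 1, q}) < pot T ∧
      pot ((T ∆ {p - 1, p}) ∆ {q - 1, q}) < pot T := by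
  have hn3 := three_le_of_card h3
  have h2 : 2 ≤ T.card := by omega
  have hg := gap_spec ht
  have hzn : gap T t < n := gap_lt_of_two_le h2
  -- notation-free facts about `t' = t + z`
  have ht' : t + (gap T t : ZMod n) ∈ T := hg.2.2
  have ht1 : t + 1 ∉ T := by
    have := not_mem_of_lt_gap (T := T) (t := t) (d := 1) le_rfl hz
    rwa [Nat.cast_one] at this
  have hcast : t + (gap T t : ZMod n) - 1 = t + ((gap T t - 1 : ℕ) : ZMod n) := by
    rw [Nat.cast_sub hg.1, Nat.cast_one]; ring
  have ht'1 : t + (gap T t : ZMod n) - 1 ∉ T := by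
    rw [hcast]; exact not_mem_of_lt_gap (by omega) (by omega)
  have ht't : t + (gap T t : ZMod n) ≠ t := by
    intro h
    have : (gap T t : ZMod n) = 0 := by have := congrArg (fun y => y - t) h; simpa using this
    have := Nat.eq_zero_of_dvd_of_lt ((ZMod.natCast_eq_zero_iff _ _).mp this) hzn
    omega
  have hlgap : gap T t ≤ lgap T t := le_lgap_of_forall_le_gap hmin ht
  have hgap' : gap T t ≤ gap T (t + (gap T t : ZMod n)) := hmin _ ht'
  have hlgap' : lgap T (t + (gap T t : ZMod n)) ≤ gap T t := lgap_le_of_mem hg.1 (by rw [add_sub_cancel_right]; exact ht)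
  -- the two single corners
  have hT1 : T ∆ {t + 1 - 1, t + 1} = insert (t + 1) (T.erase t) := by
    rw [add_sub_cancel_right]; exact symmDiff_pair_of_mem_of_not_mem ht ht1
  have hT1' : T ∆ {t + (gap T t : ZMod n) - 1, t + (gap T t : ZMod n)} =
      insert (t + (gap T t : ZMod n) - 1) (T.erase (t + (gap T t : ZMod n))) := symmDiff_pair_of_not_mem_of_mem ht'1 ht'
  have hW1 := W_slide_right h2 ht
  have hW1' := W_slide_left h2 ht'
  have hc1 : (insert (t + 1) (T.erase t)).card = T.card := card_insert_erase ht ht1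
  refine ⟨t + 1, t + (gap T t : ZMod n), ?_, ?_, ?_, ?_⟩
  · intro h
    have h1 : ((1 : ℕ) : ZMod n) = (gap T t : ZMod n) := by rw [Nat.cast_one]; exact add_left_cancel h
    have := natCast_inj_of_lt (by omega) hzn h1
    omega
  · rw [hT1]; exact pot_lt_of_W hc1 (by omega)
  · rw [hT1']; exact pot_lt_of_W (card_insert_erase ht' ht'1) (by omega)
  · rw [hT1]
    have ht'T1 : t + (gap T t : ZMod n) ∈ insert (t + 1) (T.erase t) :=
      Finset.mem_insert_of_mem (Finset.mem_erase.mpr ⟨ht't, ht'⟩)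
    by_cases hz2 : gap T t = 2
    · -- annihilation of `t` and `t + 2`
      have he : t + (gap T t : ZMod n) - 1 = t + 1 := by rw [hcast, hz2]; norm_num
      rw [he, symmDiff_pair_of_mem_of_mem (Finset.mem_insert_self _ _) ht'T1]
      refine pot_lt_of_card ?_
      have hne : t + 1 ≠ t + (gap T t : ZMod n) := by
        intro h
        have h1 : ((1 : ℕ) : ZMod n) = (gap T t : ZMod n) := by rw [Nat.cast_one]; exact add_left_cancel h
        have := natCast_inj_of_lt (by omega) hzn h1
        omega
      have := card_erase_erase (Finset.mem_insert_self (t + 1) (T.erase t)) ht'T1 hne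
      omega
    · -- two slides
      have hz3 : 3 ≤ gap T t := by omega
      have hnot : t + (gap T t : ZMod n) - 1 ∉ insert (t + 1) (T.erase t) := by
        rw [Finset.mem_insert, Finset.mem_erase, not_or]
        refine ⟨fun h => ?_, fun h => ht'1 h.2⟩
        rw [hcast] at h
        have h1 : ((gap T t - 1 : ℕ) : ZMod n) = ((1 : ℕ) : ZMod n) := by rw [Nat.cast_one]; exact add_left_cancel h
        have := natCast_inj_of_lt (by omega) (by omega) h1
        omega
      rw [symmDiff_pair_of_not_mem_of_mem hnot ht'T1]
      have h2' : 2 ≤ (insert (t + 1) (T.erase t)).card := by rw [hc1]; exact h2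
      have hW2 := W_slide_left h2' ht'T1
      -- the left gap of `t + z` in the slid set is `≤ z − 1`, its right gap is still `≥ z`
      have hl2 : lgap (insert (t + 1) (T.erase t)) (t + (gap T t : ZMod n)) ≤ gap T t - 1 := by
        refine lgap_le_of_mem (by omega) ?_
        have : t + (gap T t : ZMod n) - ((gap T t - 1 : ℕ) : ZMod n) = t + 1 := by
          rw [Nat.cast_sub hg.1, Nat.cast_one]; ring
        rw [this]; exact Finset.mem_insert_self _ _
      have hg2 : gap T t ≤ gap (insert (t + 1) (T.erase t)) (t + (gap T t : ZMod n)) := by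
        refine le_gap_of_forall ht'T1 fun d hd1 hdz hmem => ?_
        rw [Finset.mem_insert, Finset.mem_erase] at hmem
        rcases hmem with h | h
        · -- `t + z + d = t + 1` would put `t` inside the right gap of `t + z`
          by_cases hd : d = 1
          · subst hd
            rw [Nat.cast_one] at h
            exact ht't (add_right_cancel h)
          · have hpt : t + (gap T t : ZMod n) + ((d - 1 : ℕ) : ZMod n) = t := by
              have : t + (gap T t : ZMod n) + ((d - 1 : ℕ) : ZMod n) + 1 = t + 1 := by
                rw [← h, Nat.cast_sub hd1, Nat.cast_one]; ring
              exact add_right_cancel this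
            have := not_mem_of_lt_gap (T := T) (t := t + (gap T t : ZMod n)) (d := d - 1) (by omega) (by omega)
            rw [hpt] at this
            exact this ht
        · exact not_mem_of_lt_gap hd1 (lt_of_lt_of_le hdz hgap') h.2
      exact pot_lt_of_W (by rw [card_insert_erase ht'T1 hnot, hc1]) (by omega)

/-! ## §3 Rule S: the least gap has length `1` -/

section RuleS

variable {T : Finset (ZMod n)} {t u : ZMod n}

omit [NeZero n] in
/-- The annihilating corner of Rule S: toggling the members `t, t + 1`. [folklore] -/
theorem corner_annihilate (hn : 2 ≤ n) (ht : t ∈ T) (ht1 : t + 1 ∈ T) :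
    T ∆ {t + 1 - 1, t + 1} = (T.erase t).erase (t + 1) ∧ ((T.erase t).erase (t + 1)).card + 2 = T.card := by
  rw [add_sub_cancel_right, symmDiff_pair_of_mem_of_mem ht ht1]
  exact ⟨rfl, card_erase_erase ht ht1 (add_one_ne hn t).symm⟩

/-- **RULE S, `w = 1`**: `u, u + 1 ∈ T` with `u ≠ t`; places `t + 1`, `u + 1`. [folklore] -/
theorem ruleS_one (h3 : 3 ≤ T.card) (ht : t ∈ T) (ht1 : t + 1 ∈ T) (hu : u ∈ T) (hut : u ≠ t) (hu1 : u + 1 ∈ T) :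
    ∃ p q : ZMod n, p ≠ q ∧ pot (T ∆ {p - 1, p}) < pot T ∧ pot (T ∆ {q - 1, q}) < pot T ∧
      pot ((T ∆ {p - 1, p}) ∆ {q - 1, q}) < pot T := by
  have hn3 := three_le_of_card h3
  obtain ⟨hTt, hct⟩ := corner_annihilate (by omega) ht ht1
  obtain ⟨hTu, hcu⟩ := corner_annihilate (by omega) hu hu1
  refine ⟨t + 1, u + 1, fun h => hut.symm (add_right_cancel h), ?_, ?_, ?_⟩
  · rw [hTt]; exact pot_lt_of_card (by omega)
  · rw [hTu]; exact pot_lt_of_card (by omega)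
  · rw [hTt, add_sub_cancel_right]
    refine pot_lt_of_card ?_
    have hmeet : u ∈ (T.erase t).erase (t + 1) ∨ u + 1 ∈ (T.erase t).erase (t + 1) := by
      by_cases hut1 : u = t + 1
      · right
        refine Finset.mem_erase.mpr ⟨?_, Finset.mem_erase.mpr ⟨?_, hu1⟩⟩
        · rw [hut1]; exact add_one_ne (by omega) _
        · intro h
          rw [hut1] at h
          have e : t + 1 + 1 = t + ((2 : ℕ) : ZMod n) := by push_cast; ring
          rw [e] at h
          have h2 : ((2 : ℕ) : ZMod n) = 0 := by simpa using h
          have := Nat.eq_zero_of_dvd_of_lt ((ZMod.natCast_eq_zero_iff _ _).mp h2) (by omega)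
          omega
      · left
        exact Finset.mem_erase.mpr ⟨hut1, Finset.mem_erase.mpr ⟨hut, hu⟩⟩
    have := card_symmDiff_pair_le (add_one_ne (by omega) u).symm hmeet
    omega

/-- **RULE S, `w ≥ 2`, far case**: `u ≠ t + 1` has the least right gap `w ≥ 2` among `T ∖ {t}`; places `t + 1`, `u + 1`. [folklore] -/
theorem ruleS_far (h3 : 3 ≤ T.card) (ht : t ∈ T) (ht1 : t + 1 ∈ T) (hu : u ∈ T) (hut : u ≠ t) (hut1 : u ≠ t + 1)
    (humin : ∀ v ∈ T.erase t, gap T u ≤ gap T v) (hw : 2 ≤ gap T u) :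
    ∃ p q : ZMod n, p ≠ q ∧ pot (T ∆ {p - 1, p}) < pot T ∧ pot (T ∆ {q - 1, q}) < pot T ∧
      pot ((T ∆ {p - 1, p}) ∆ {q - 1, q}) < pot T := by
  have hn3 := three_le_of_card h3
  have h2 : 2 ≤ T.card := by omega
  obtain ⟨hTt, hct⟩ := corner_annihilate (by omega) ht ht1
  have hu1 : u + 1 ∉ T := by
    have := not_mem_of_lt_gap (T := T) (t := u) (d := 1) le_rfl hw
    rwa [Nat.cast_one] at this
  -- the left gap of `u` is `≥ w` (minimum symmetry with `t` excluded)
  have hlu : gap T u ≤ lgap T u := by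
    refine le_lgap_of_forall hu fun d hd1 hdw hmem => ?_
    by_cases hv : u - (d : ZMod n) = t
    · have hud : u = t + (d : ZMod n) := by rw [← hv, sub_add_cancel]
      by_cases hd : d = 1
      · subst hd; rw [Nat.cast_one] at hud; exact hut1 hud
      · have hmin := humin (t + 1) (Finset.mem_erase.mpr ⟨add_one_ne (by omega) t, ht1⟩)
        have := not_mem_of_lt_gap (T := T) (t := t + 1) (d := d - 1) (by omega) (by omega)
        have hpt : t + 1 + ((d - 1 : ℕ) : ZMod n) = u := by rw [hud, Nat.cast_sub hd1, Nat.cast_one]; ring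
        rw [hpt] at this
        exact this hu
    · have hmin := humin _ (Finset.mem_erase.mpr ⟨hv, hmem⟩)
      have := not_mem_of_lt_gap (T := T) (t := u - (d : ZMod n)) (d := d) hd1 (lt_of_lt_of_le hdw hmin)
      rw [sub_add_cancel] at this
      exact this hu
  have hTu : T ∆ {u + 1 - 1, u + 1} = insert (u + 1) (T.erase u) := by
    rw [add_sub_cancel_right]; exact symmDiff_pair_of_mem_of_not_mem hu hu1
  have hW := W_slide_right h2 hu
  refine ⟨t + 1, u + 1, fun h => hut.symm (add_right_cancel h), ?_, ?_, ?_⟩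
  · rw [hTt]; exact pot_lt_of_card (by omega)
  · rw [hTu]; exact pot_lt_of_W (card_insert_erase hu hu1) (by omega)
  · rw [hTt, add_sub_cancel_right]
    have huT1 : u ∈ (T.erase t).erase (t + 1) := Finset.mem_erase.mpr ⟨hut1, Finset.mem_erase.mpr ⟨hut, hu⟩⟩
    have hu1T1 : u + 1 ∉ (T.erase t).erase (t + 1) := fun h =>
      hu1 (Finset.mem_of_mem_erase (Finset.mem_of_mem_erase h))
    rw [symmDiff_pair_of_mem_of_not_mem huT1 hu1T1]
    exact pot_lt_of_card (by rw [card_insert_erase huT1 hu1T1]; omega)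

/-- **RULE S, `w ≥ 2`, near case**: `u = t + 1` has the least right gap `w ≥ 2` among `T ∖ {t}`; places `t + 1`, `u + w` — the successor
`u + w` of `u` is not `t` because `T` has a third member. [folklore] -/
theorem ruleS_near (h3 : 3 ≤ T.card) (ht : t ∈ T) (ht1 : t + 1 ∈ T) (humin : ∀ v ∈ T.erase t, gap T (t + 1) ≤ gap T v)
    (hw : 2 ≤ gap T (t + 1)) :
    ∃ p q : ZMod n, p ≠ q ∧ pot (T ∆ {p - 1, p}) < pot T ∧ pot (T ∆ {q - 1, q}) < pot T ∧
      pot ((T ∆ {p - 1, p}) ∆ {q - 1, q}) < pot T := by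
  have hn3 := three_le_of_card h3
  have h2 : 2 ≤ T.card := by omega
  obtain ⟨hTt, hct⟩ := corner_annihilate (by omega) ht ht1
  have hg := gap_spec ht1
  have hwn : gap T (t + 1) < n := gap_lt_of_two_le h2
  -- `u' = t + 1 + w`, the successor of `u = t + 1`
  have hu' : t + 1 + (gap T (t + 1) : ZMod n) ∈ T := hg.2.2
  have hcast : t + 1 + (gap T (t + 1) : ZMod n) - 1 = t + 1 + ((gap T (t + 1) - 1 : ℕ) : ZMod n) := by
    rw [Nat.cast_sub hg.1, Nat.cast_one]; ring
  have hu'1 : t + 1 + (gap T (t + 1) : ZMod n) - 1 ∉ T := by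
    rw [hcast]; exact not_mem_of_lt_gap (by omega) (by omega)
  have hu'u : t + 1 + (gap T (t + 1) : ZMod n) ≠ t + 1 := by
    intro h
    have : (gap T (t + 1) : ZMod n) = 0 := by have := congrArg (fun y => y - (t + 1)) h; simpa using this
    have := Nat.eq_zero_of_dvd_of_lt ((ZMod.natCast_eq_zero_iff _ _).mp this) hwn
    omega
  -- KEY: `u' ≠ t`, from a third member
  have hu't : t + 1 + (gap T (t + 1) : ZMod n) ≠ t := by
    intro hu't
    obtain ⟨v, hv⟩ : ((T.erase t).erase (t + 1)).Nonempty := Finset.card_pos.mp (by omega)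
    rw [Finset.mem_erase, Finset.mem_erase] at hv
    obtain ⟨hvt1, hvt, hvT⟩ := hv
    obtain ⟨j, hjn, hvj, hj1⟩ := exists_eq_add_nat (t + 1) v
    have hj1 := hj1 hvt1
    rcases Nat.lt_trichotomy j (gap T (t + 1)) with hlt | heq | hgt
    · exact not_mem_of_lt_gap hj1 hlt (hvj ▸ hvT)
    · exact hvt (by rw [hvj, heq, hu't])
    · -- `v = t + (j − w)`: compare the two offsets of `v` from `t + 1`
      have hvj' : v = t + ((j - gap T (t + 1) : ℕ) : ZMod n) := by
        calc v = t + 1 + (gap T (t + 1) : ZMod n) + ((j - gap T (t + 1) : ℕ) : ZMod n) := by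
              rw [hvj, Nat.cast_sub hgt.le]; ring
          _ = t + ((j - gap T (t + 1) : ℕ) : ZMod n) := by rw [hu't]
      by_cases hj : j - gap T (t + 1) = 1
      · rw [hj, Nat.cast_one] at hvj'; exact hvt1 hvj'
      · obtain ⟨m, hm⟩ : ∃ m : ℕ, j - gap T (t + 1) = m + 1 := ⟨j - gap T (t + 1) - 1, by omega⟩
        have hvj'' : v = t + 1 + (m : ZMod n) := by
          rw [hvj', hm, Nat.cast_add, Nat.cast_one]; ring
        have := eq_of_add_natCast_eq hjn (by omega) (hvj.symm.trans hvj'')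
        omega
  have hgap' : gap T (t + 1) ≤ gap T (t + 1 + (gap T (t + 1) : ZMod n)) := humin _ (Finset.mem_erase.mpr ⟨hu't, hu'⟩)
  have hlgap' : lgap T (t + 1 + (gap T (t + 1) : ZMod n)) ≤ gap T (t + 1) :=
    lgap_le_of_mem hg.1 (by rw [add_sub_cancel_right]; exact ht1)
  have hTq : T ∆ {t + 1 + (gap T (t + 1) : ZMod n) - 1, t + 1 + (gap T (t + 1) : ZMod n)} =
      insert (t + 1 + (gap T (t + 1) : ZMod n) - 1) (T.erase (t + 1 + (gap T (t + 1) : ZMod n))) :=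
    symmDiff_pair_of_not_mem_of_mem hu'1 hu'
  have hW := W_slide_left h2 hu'
  refine ⟨t + 1, t + 1 + (gap T (t + 1) : ZMod n), hu'u.symm, ?_, ?_, ?_⟩
  · rw [hTt]; exact pot_lt_of_card (by omega)
  · rw [hTq]; exact pot_lt_of_W (card_insert_erase hu' hu'1) (by omega)
  · rw [hTt]
    have hin : t + 1 + (gap T (t + 1) : ZMod n) ∈ (T.erase t).erase (t + 1) :=
      Finset.mem_erase.mpr ⟨hu'u, Finset.mem_erase.mpr ⟨hu't, hu'⟩⟩
    have hout : t + 1 + (gap T (t + 1) : ZMod n) - 1 ∉ (T.erase t).erase (t + 1) := fun h =>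
      hu'1 (Finset.mem_of_mem_erase (Finset.mem_of_mem_erase h))
    rw [symmDiff_pair_of_not_mem_of_mem hout hin]
    exact pot_lt_of_card (by rw [card_insert_erase hin hout]; omega)

end RuleS

/-! ## §4 The descent step -/

/-- **EVERY BOUNDARY SET OF SIZE `≥ 3` HAS A POTENTIAL-LOWERING PAIR OF PLACES**: there are `p ≠ q` in `ℤ/n` such that the corners
`T ∆ {p−1, p}`, `T ∆ {q−1, q}`, `T ∆ {p−1, p} ∆ {q−1, q}` all have potential `< pot T`. [folklore] -/
theorem exists_places (T : Finset (ZMod n)) (h3 : 3 ≤ T.card) :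
    ∃ p q : ZMod n, p ≠ q ∧ pot (T ∆ {p - 1, p}) < pot T ∧ pot (T ∆ {q - 1, q}) < pot T ∧
      pot ((T ∆ {p - 1, p}) ∆ {q - 1, q}) < pot T := by
  have hn3 := three_le_of_card h3
  have h2 : 2 ≤ T.card := by omega
  obtain ⟨t, ht, hmin⟩ := Finset.exists_min_image T (gap T) (Finset.card_pos.mp (by omega))
  have hg := gap_spec ht
  by_cases hz : 2 ≤ gap T t
  · exact ruleM h3 ht hmin hz
  · -- the least gap is `1`: `t + 1 ∈ T`
    have ht1 : t + 1 ∈ T := by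
      have h1 : gap T t = 1 := by omega
      have := hg.2.2
      rwa [h1, Nat.cast_one] at this
    have hne : (T.erase t).Nonempty := ⟨t + 1, Finset.mem_erase.mpr ⟨add_one_ne (by omega) t, ht1⟩⟩
    obtain ⟨u, hu, humin⟩ := Finset.exists_min_image (T.erase t) (gap T) hne
    obtain ⟨hut, huT⟩ := Finset.mem_erase.mp hu
    have hgu := gap_spec huT
    by_cases hw : 2 ≤ gap T u
    · by_cases hut1 : u = t + 1
      · subst hut1
        exact ruleS_near h3 ht ht1 humin hw
      · exact ruleS_far h3 ht ht1 huT hut hut1 humin hw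
    · have hu1 : u + 1 ∈ T := by
        have h1 : gap T u = 1 := by omega
        have := hgu.2.2
        rwa [h1, Nat.cast_one] at this
      exact ruleS_one h3 ht ht1 huT hut hu1

end Summit.HodgeConjecture.CorCM.Census.CyclicBoundary
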